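import Literature.NumberTheory.LFunctions.GL2HarmonicFamily
import Mathlib.NumberTheory.LSeries.DirichletContinuation
import Mathlib.Analysis.Analytic.Order
import Mathlib.Analysis.SpecialFunctions.Pow.Real
import HarnessLib

/-!
# Analytic ranks of weight-two newforms of prime level and Landau–Siegel zeros
# (Bui–Pratt–Zaharescu 2024, Theorem 1.2)

Topic `Literature/NumberTheory/LFunctions` (namespace `Literature.NumberTheory.LFunctions`; the
paper's objects in the sub-namespace `BPZ2024`, one dot-notation extension `GL2Family.analyticRank` of
the tree's `GL(2)` family vocabulary). STATEMENT LAYER (D-0014): TWO named facts — the two cases of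
Theorem 1.2 — typed for the cell `landau-siegel` (rung F-S3, §C harvest row T-025 / P-013; tag E*-fam,
INVERSE direction: an exceptional character FORCES almost all `f ∈ S₂*(q)` to have analytic rank `≤ 1`
resp. `≤ 2` for primes `q ∈ [D^{750}, D^C]`; nothing here asserts that an exceptional character exists —
both statements are printed as UNCONDITIONAL inequalities whose error terms involve `L(1,ψ)`).

## What the source prints (held text `paper:arxiv-2102.03087`, PDF text, 50 pp., read 2026-08-26)

H. M. Bui, K. Pratt, A. Zaharescu, *Analytic ranks of automorphic `L`-functions and Landau–Siegel
zeros*, J. London Math. Soc. (2) 109 (2024) e12834 = arXiv:2102.03087 [BuiPrattZaharescu2023].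
§1 (p. 2): "Given a newform `f` of weight two and prime level `q` (i.e. `f ∈ S₂*(q)`), we denote its
corresponding `L`-function by `L(f, s)` … We define the analytic rank `r_f` to be the order of
vanishing of `L(f, s)` at `s = 1/2`." §2 (p. 3): "Let `S₂*(q)` be the set of primitive Hecke
eigenforms of weight `2` and level `q` (`q` prime). … `f(z) = Σ_{n≥1} √n λ_f(n) e(nz)` with
`λ_f(1) = 1`. The `L`-function associated to `f`, `L(f, s) = Σ_{n≥1} λ_f(n) n^{−s}`" (analytic
normalisation: centre `s = ½`).

> **Theorem 1.2** (pp. 2–3). Let `C ≥ 750` be a fixed real number. Let `D` be large and let `ψ` be a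
> real, odd, primitive Dirichlet character modulo `D`. Then for any `ε > 0` and any prime `q`
> satisfying `D^{750} ≤ q ≤ D^C` we have
> `(1/|S₂*(q)|) Σ_{f ∈ S₂*(q), r_f ≤ 1} 1 = 1 + O_ε(L(1,ψ)(log q)^{45+ε}) + O_ε(L(1,ψ)²(log q)^{56+ε}) + O_A((log q)^{−A})`
> if `ψ(q) = 1`, and
> `(1/|S₂*(q)|) Σ_{f ∈ S₂*(q), r_f ≤ 2} 1 = 1 + O(log log(1/(L(1,ψ) log D)) / log(1/(L(1,ψ) log D))) + O_ε(L(1,ψ)(log q)^{45+ε}) + O_ε(L(1,ψ)²(log q)^{56+ε})`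
> if `ψ(q) = −1` and `L(1,ψ)(log D) = o(1)`.

"Remark. For convenience we work only with weight two forms, but one could prove an analogue of
Theorem 1.2 in which the weight is any fixed, even `k ≥ 2`." (typed for `k = 2` only, as printed.)
Theorem 1.1 (the dichotomy `L(1,ψ) ≥ (log D)^{−50}` OR `rank(J₀(q)) = (½ + O(…)) dim(J₀(q))`) "is a
direct consequence" (§14, p. 43: "Theorem 1.1 is a result about the natural average of analytic ranks
of `L`-functions"); it is typed at the END of this file (`buiPrattZaharescu2024_theorem11`, appended; row T-024) with
`rank(J₀(q))` in the source's own ANALYTIC reading (`BPZ2024.analyticRankJ0`), flagged for the referee.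

## Lean rendering / design choices (audit notes for ls-lit-ref)

* `S₂*(q)` = the tree's `newforms0 q 2` (normalised Hecke eigenforms in the new subspace of
  `S₂(Γ₀(q))`, `Literature/NumberTheory/EllipticCurves/Newforms.lean`; for prime `q` and weight `2`
  every form is new); `|S₂*(q)| = Set.ncard` (finite: the tree's fact `finite_newforms0`).
* `L(f, s)` continued = the tree's entire `GL2Family.cuspFormLStar f` (classical normalisation, centre
  `s = k/2 = 1` for weight `2`; `GL2HarmonicFamily.lean`, `centralValue f = cuspFormLStar f (k/2)`).
  The ONE new notion: `GL2Family.analyticRank f := analyticOrderNatAt (cuspFormLStar f) (k/2)` — the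
  order of vanishing at the central point, exactly as `WeierstrassCurve.analyticRank`
  (`EllipticCurves/AnalyticRank.lean`) does for `L(E, s)` at `s = 1` (Mathlib `analyticOrderNatAt`;
  junk `0` if the function were not analytic there or vanished identically nearby).
* `ψ` "real, odd, primitive mod `D`": `ψ.IsPrimitive`, `ψ.IsQuadratic`, `ψ.Odd`; `L(1,ψ)` (real,
  positive) is `‖ψ.LFunction 1‖`; `ψ(q) = ±1` is `ψ (q : ZMod D) = ±1`.
* "`D` large", "`C ≥ 750` fixed", "`O_ε`, `O_A`": `∀ C ≥ 750, ∀ ε > 0, ∀ A > 0, ∃ K > 0, ∃ D₀, ∀ D ≥ D₀`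
  (one constant `K = K(C, ε, A)` in front of the sum of the printed error quantities — equivalent to
  three). `D^{750} ≤ q ≤ D^C` with real powers. Exponents `(log q)^{45+ε}` etc. are `Real.rpow`.
* "`= 1 + O(…)`" for a proportion that is `≤ 1` by definition is rendered as the LOWER bound
  `≥ 1 − K(…)` (the tree's convention for Čech–Matomäki 2024, `ExceptionalCharacterCentralValues.lean`).
* Case `ψ(q) = −1`: the printed side condition "`L(1,ψ)(log D) = o(1)`" (§2: "where `o(1)` denotes a
  quantity that tends to zero as `D → ∞`") is rendered UNIFORMLY: `∃ δ₀ > 0` such that the bound holds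
  whenever `L(1,ψ) log D ≤ δ₀` (and `D ≥ D₀`). This is equivalent to the sequential reading (for
  every family with `L(1,ψ_D) log D → 0` the bound holds for large `D` with some constant): uniform ⇒
  sequential trivially; conversely, if no `(δ₀, K, D₀) = (1/n, n, n)` worked, the violators would form a
  family with `L(1,ψ) log D → 0` along which no constant works. The unbounded-log term is written with
  `x = L(1,ψ) log D`, `log log(1/x)/log(1/x)` (positive for `x < e^{−1}`; `δ₀` may be taken `< e^{−e}`).

WHAT THIS IS NOT: no claim about `rank J₀(q)` (Mordell–Weil) and no use of BSD; no claim that an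
exceptional `ψ` exists; not Theorem 1.1 (see above); weight `2` only.

## References

* [BuiPrattZaharescu2023] H. M. Bui, K. Pratt, A. Zaharescu, J. London Math. Soc. 109 (2024) e12834 =
  arXiv:2102.03087: §1 Theorem 1.2 (pp. 2–3 of the held text), §2 (set-up, p. 3), §14 (p. 43).
* H. Iwaniec, E. Kowalski, *Analytic Number Theory*, AMS Colloq. Publ. 53 (2004), §14.6, §26.1 (the
  normalisations behind `GL2Family.cuspFormLStar` / `centralValue`). [IwaniecKowalski2004]
-/

noncomputable section

open scoped MatrixGroups ModularForm Real

open CongruenceSubgroup Complex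

namespace Literature.NumberTheory.LFunctions

namespace GL2Family

open Literature.NumberTheory.EllipticCurves.ModularForms

variable {Γ : Subgroup (GL (Fin 2) ℝ)} {k : ℤ}

/-- The **analytic rank** `r_f := ord_{s = ½} L(f, s)` of a cusp form — in the classical
normalisation of the tree's entire `L`-function `L^*(f, s) = cuspFormLStar f s`, the order of
vanishing at the central point `s = k/2` (Mathlib `analyticOrderNatAt`; junk value `0` if `L^*(f,·)`
were not analytic at `k/2` or vanished identically near it). For `f ∈ S₂*(q)` this is
Bui–Pratt–Zaharescu's `r_f` ("the order of vanishing of `L(f,s)` at `s = 1/2`", analytic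
normalisation). [cite: BuiPrattZaharescu2023, §1 (definition of r_f)] -/
def analyticRank (f : CuspForm Γ k) : ℕ :=
  analyticOrderNatAt (cuspFormLStar f) ((k : ℂ) / 2)

/-- Unfolding `analyticRank`. [cite: BuiPrattZaharescu2023, §1 (definition of r_f)] -/
theorem analyticRank_def (f : CuspForm Γ k) :
    analyticRank f = analyticOrderNatAt (cuspFormLStar f) ((k : ℂ) / 2) :=
  rfl

end GL2Family

namespace BPZ2024

open Literature.NumberTheory.EllipticCurves.ModularForms GL2Family

/-- **The proportion of `S₂*(q)` with analytic rank `≤ r`**: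
`(1/|S₂*(q)|) · #{f ∈ S₂*(q) : r_f ≤ r}`, with `S₂*(q) = newforms0 q 2` (a junk `0/0 = 0` if there
were no newforms; `|S₂*(q)| = g(X₀(q)) ≥ 1` for the primes `q` in play).
[cite: BuiPrattZaharescu2023, §1 Theorem 1.2] -/
def lowRankProportion (q : ℕ) [NeZero q] (r : ℕ) : ℝ :=
  (Set.ncard {f : CuspForm (Gamma0 q) 2 | f ∈ newforms0 q 2 ∧ analyticRank f ≤ r} : ℝ) /
    (Set.ncard (newforms0 q 2) : ℝ)

/-- The counted set is a subset of `S₂*(q)`, so (when `S₂*(q)` is finite) the proportion is at most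
`1` — which is why "`= 1 + O(…)`" is typed as a lower bound.
[cite: BuiPrattZaharescu2023, §1 Theorem 1.2] -/
theorem lowRankProportion_le_one (q : ℕ) [NeZero q] (r : ℕ) (hfin : (newforms0 q 2).Finite) :
    lowRankProportion q r ≤ 1 := by
  unfold lowRankProportion
  have hsub : {f : CuspForm (Gamma0 q) 2 | f ∈ newforms0 q 2 ∧ analyticRank f ≤ r} ⊆ newforms0 q 2 :=
    fun f hf => hf.1
  have hle : (Set.ncard {f : CuspForm (Gamma0 q) 2 | f ∈ newforms0 q 2 ∧ analyticRank f ≤ r} : ℝ) ≤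
      (Set.ncard (newforms0 q 2) : ℝ) := by
    exact_mod_cast Set.ncard_le_ncard hsub hfin
  rcases eq_or_lt_of_le (Nat.cast_nonneg (α := ℝ) (Set.ncard (newforms0 q 2))) with h0 | hpos
  · rw [← h0, div_zero]; exact zero_le_one
  · rwa [div_le_one hpos]

/-- `lowRankProportion` is non-negative. [cite: BuiPrattZaharescu2023, §1 Theorem 1.2] -/
theorem lowRankProportion_nonneg (q : ℕ) [NeZero q] (r : ℕ) : 0 ≤ lowRankProportion q r := by
  unfold lowRankProportion; positivity

end BPZ2024

open BPZ2024

/-- **Bui–Pratt–Zaharescu 2024, Theorem 1.2, case `ψ(q) = 1`** (NAMED FACT, AS PRINTED). For every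
fixed `C ≥ 750`, `ε > 0`, `A > 0` there are `K > 0` and `D₀` such that: for `D ≥ D₀`, every real odd
primitive `ψ` mod `D`, and every prime `q` with `D^{750} ≤ q ≤ D^C` and `ψ(q) = 1`,
`(1/|S₂*(q)|) #{f ∈ S₂*(q) : r_f ≤ 1} ≥ 1 − K (L(1,ψ)(log q)^{45+ε} + L(1,ψ)²(log q)^{56+ε} + (log q)^{−A})`
— i.e. "`= 1 + O_ε(L(1,ψ)(log q)^{45+ε}) + O_ε(L(1,ψ)²(log q)^{56+ε}) + O_A((log q)^{−A})`".
Non-trivial only when `L(1,ψ)` is abnormally small (an exceptional `ψ`); nothing here asserts that.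
Status: theorem-in-print, not proved here (mollified first and second moments of `L(f⊗?,½)`-type
central values over `S₂*(q)` with the lacunary coefficients `λ_f ∗ ψ`, §§3–14 of the source).
[cite: BuiPrattZaharescu2023, §1 Theorem 1.2 (case ψ(q) = 1)] -/
def buiPrattZaharescu2024_theorem12_split : Prop :=
  ∀ C : ℝ, 750 ≤ C → ∀ ε : ℝ, 0 < ε → ∀ A : ℝ, 0 < A →
    ∃ K : ℝ, 0 < K ∧ ∃ D₀ : ℕ, ∀ (D : ℕ) [NeZero D], D₀ ≤ D →
      ∀ ψ : DirichletCharacter ℂ D, ψ.IsPrimitive → ψ.IsQuadratic → ψ.Odd →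
        ∀ (q : ℕ) [NeZero q], q.Prime → (D : ℝ) ^ (750 : ℝ) ≤ (q : ℝ) → (q : ℝ) ≤ (D : ℝ) ^ C →
          ψ (q : ZMod D) = 1 →
          1 - K * (‖ψ.LFunction 1‖ * Real.log q ^ (45 + ε)
                + ‖ψ.LFunction 1‖ ^ 2 * Real.log q ^ (56 + ε)
                + Real.log q ^ (-A))
            ≤ lowRankProportion q 1

/-- **Bui–Pratt–Zaharescu 2024, Theorem 1.2, case `ψ(q) = −1`** (NAMED FACT, AS PRINTED, with the
side condition "`L(1,ψ)(log D) = o(1)`" rendered uniformly — see the module docstring). For every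
fixed `C ≥ 750` and `ε > 0` there are `δ₀ > 0`, `K > 0` and `D₀` such that: for `D ≥ D₀`, every real
odd primitive `ψ` mod `D` with `x := L(1,ψ) log D ≤ δ₀`, and every prime `q` with
`D^{750} ≤ q ≤ D^C` and `ψ(q) = −1`,
`(1/|S₂*(q)|) #{f ∈ S₂*(q) : r_f ≤ 2} ≥ 1 − K (log log(1/x)/log(1/x) + L(1,ψ)(log q)^{45+ε} + L(1,ψ)²(log q)^{56+ε})`
— i.e. "`= 1 + O(log log(1/(L(1,ψ) log D))/log(1/(L(1,ψ) log D))) + O_ε(…) + O_ε(…)`".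
Status: theorem-in-print, not proved here. [cite: BuiPrattZaharescu2023, §1 Theorem 1.2 (case ψ(q) = −1)] -/
def buiPrattZaharescu2024_theorem12_inert : Prop :=
  ∀ C : ℝ, 750 ≤ C → ∀ ε : ℝ, 0 < ε →
    ∃ δ₀ : ℝ, 0 < δ₀ ∧ ∃ K : ℝ, 0 < K ∧ ∃ D₀ : ℕ, ∀ (D : ℕ) [NeZero D], D₀ ≤ D →
      ∀ ψ : DirichletCharacter ℂ D, ψ.IsPrimitive → ψ.IsQuadratic → ψ.Odd →
        ‖ψ.LFunction 1‖ * Real.log D ≤ δ₀ →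
        ∀ (q : ℕ) [NeZero q], q.Prime → (D : ℝ) ^ (750 : ℝ) ≤ (q : ℝ) → (q : ℝ) ≤ (D : ℝ) ^ C →
          ψ (q : ZMod D) = -1 →
          1 - K * (Real.log (Real.log (1 / (‖ψ.LFunction 1‖ * Real.log D))) /
                    Real.log (1 / (‖ψ.LFunction 1‖ * Real.log D))
                + ‖ψ.LFunction 1‖ * Real.log q ^ (45 + ε)
                + ‖ψ.LFunction 1‖ ^ 2 * Real.log q ^ (56 + ε))
            ≤ lowRankProportion q 2


/-! ### Theorem 1.1: the rank of `J₀(q)` in the analytic reading of the source (§14) -/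

namespace BPZ2024

open Literature.NumberTheory.EllipticCurves.ModularForms GL2Family

/-- **The analytic rank of `J₀(q)`**: `rank(J₀(q)) := Σ_{f ∈ S₂*(q)} r_f`, which by the factorisation
`L(J₀(q), s) = ∏_{f ∈ S₂*(q)} L(f, s)` ((1.1) of the source) is the order of vanishing of `L(J₀(q), s)`
at the central point. THIS is the quantity Theorem 1.1 of the source controls: §14, p. 43, "Theorem
1.1 is a result about the natural average of analytic ranks of `L`-functions", the upper bound being
proved through `(1/|S₂*(q)|) Σ_{r_f ≥ 3} r_f` (p. 43). No Mordell–Weil rank, no abelian variety and no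
BSD statement is involved in this definition (the source's Gross–Zagier sentence on p. 43 glosses the
`r_f = 1` part and is not used here). A `finsum` over the finite set `newforms0 q 2`.
[cite: BuiPrattZaharescu2023, §1 (1.1) and §14 (p. 43)] -/
def analyticRankJ0 (q : ℕ) [NeZero q] : ℕ :=
  ∑ᶠ f ∈ newforms0 q 2, analyticRank f

/-- **`dim J₀(q) = g(X₀(q)) = |S₂*(q)|`** for prime `q` (all weight-two forms of prime level are new):
the cardinality of `newforms0 q 2`. [cite: BuiPrattZaharescu2023, §1 (1.1)] -/
def dimJ0 (q : ℕ) [NeZero q] : ℕ :=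
  Set.ncard (newforms0 q 2)

end BPZ2024

/-- **Bui–Pratt–Zaharescu 2024, Theorem 1.1** (NAMED FACT, AS PRINTED, with `rank(J₀(q))` READ AS THE
ANALYTIC RANK `Σ_{f ∈ S₂*(q)} r_f` and `dim(J₀(q)) = |S₂*(q)|` — the source's own reading, §14 p. 43;
see `BPZ2024.analyticRankJ0`). "Let `D` be large and let `ψ` be a real, odd, primitive Dirichlet
character modulo `D`. Then one of the following two possibilities must hold: (A)
`L(1,ψ) ≥ (log D)^{−50}`, or (B) for every fixed `C ≥ 750` and every prime `q` satisfying
`D^{750} ≤ q ≤ D^C` we have `rank(J₀(q)) = (½ + O(√(log log log q / log log q))) dim(J₀(q))` if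
`ψ(q) = 1`, and `(½ + O(log log log q / log log q)) dim(J₀(q)) ≤ rank(J₀(q)) ≤ (1 + O(√(log log log q /
log log q))) dim(J₀(q))` if `ψ(q) = −1`." Rendered `∀ C ≥ 750, ∃ K > 0, ∃ D₀, ∀ D ≥ D₀, ∀ ψ: (A) ∨ (B_C)`
with ONE constant `K = K(C)` for the three `O(·)` and the lower `O` in the `ψ(q) = −1` case read as a
two-sided perturbation of the factor `½` (typed as the lower bound `(½ − K·r) dim ≤ rank`, the
printed content). Status: theorem-in-print ("a direct consequence of Theorem 1.2", with
Kowalski–Michel–VanderKam's second-moment bound `Σ r_f² ≪ |S₂*(q)|`, [20, Thm 8.1], for the upper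
bound), not proved here. [cite: BuiPrattZaharescu2023, §1 Theorem 1.1] -/
def buiPrattZaharescu2024_theorem11 : Prop :=
  ∀ C : ℝ, 750 ≤ C → ∃ K : ℝ, 0 < K ∧ ∃ D₀ : ℕ, ∀ (D : ℕ) [NeZero D], D₀ ≤ D →
    ∀ ψ : DirichletCharacter ℂ D, ψ.IsPrimitive → ψ.IsQuadratic → ψ.Odd →
      Real.log D ^ (-(50 : ℝ)) ≤ ‖ψ.LFunction 1‖ ∨
      ∀ (q : ℕ) [NeZero q], q.Prime → (D : ℝ) ^ (750 : ℝ) ≤ (q : ℝ) → (q : ℝ) ≤ (D : ℝ) ^ C →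
        (ψ (q : ZMod D) = 1 →
          |(analyticRankJ0 q : ℝ) - (dimJ0 q : ℝ) / 2| ≤
            K * Real.sqrt (Real.log (Real.log (Real.log q)) / Real.log (Real.log q)) * dimJ0 q) ∧
        (ψ (q : ZMod D) = -1 →
          (1 / 2 - K * (Real.log (Real.log (Real.log q)) / Real.log (Real.log q))) * dimJ0 q ≤
              analyticRankJ0 q ∧
            (analyticRankJ0 q : ℝ) ≤
              (1 + K * Real.sqrt (Real.log (Real.log (Real.log q)) / Real.log (Real.log q))) * dimJ0 q)

end Literature.NumberTheory.LFunctions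

end
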